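import Mathlib
import HarnessLib
import Literature.ComputerArithmetic.BrentZimmermann2010.FreeFormatOutput
import Literature.ComputerArithmetic.BrentZimmermann2010.DoubleRounding

/-!
# Goldberg, *What every computer scientist should know about floating-point arithmetic* —
# "Binary to Decimal Conversion", Theorem 15: 8 decimal digits do not recover a binary32 number,
# 9 do; 17 are required for binary64

David Goldberg, *What every computer scientist should know about floating-point arithmetic*,
ACM Computing Surveys 23 (1991) 5–48, section "The Details — Binary to Decimal Conversion"
(p. 218 of the edited reprint held as `paper:galaxy-pdf-2700773380833947720`). [cite: Goldberg1991]

Typed for the engines group (unit `eng-cap-1`; HONEST FRAMING: shared numerical engines serving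
client cells; rigour lives in the verifiers; every published number belongs to a client cell's
ledger, not to the engines group) as the NECESSITY companion of
`Literature.ComputerArithmetic.BrentZimmermann2010.FreeFormatOutput`: that file proves the
sufficient round-trip condition `b^p < B^(P−1)` of Brent–Zimmermann §3.6.1 and its instances
"17 digits for binary64, 9 for binary32" (`binary64_decimal17_readBack`,
`binary32_decimal9_readBack`); the present file proves, after Goldberg, that one digit fewer
FAILS in both cases, so that 9 and 17 are exactly the least decimal precisions from which every
binary32 / binary64 number is recovered by rounding to nearest (`binary32_readBack_iff`,
`binary64_readBack_iff`). The `cap` B-verifiers' decimal-literal rules (`[B-literal-2]`,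
`[B-literal-3]`: a bare literal denotes the binary64 number it reads as, printed back as its
shortest round-trip literal) rest on the sufficiency direction; the necessity direction is why
such a literal may need as many as 17 significant digits. Only the printed mathematics is
formalised; no claim about any program is made in this file.

## The text being formalised (reprint p. 218)

"**Binary to Decimal Conversion.** Since single precision has `p = 24`, and `2^24 < 10^8`, you
might expect that converting a binary number to 8 decimal digits would be sufficient to recover
the original binary number. However, this is not the case.

**Theorem 15.** When a binary IEEE single precision number is converted to the closest eight
digit decimal number, it is not always possible to uniquely recover the binary number from the
decimal one. However, if nine decimal digits are used, then converting the decimal number to the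
closest binary number will recover the original floating-point number.

*Proof.* Binary single precision numbers lying in the half open interval `[10^3, 2^10) =
[1000, 1024)` have 10 bits to the left of the binary point, and 14 bits to the right of the
binary point. Thus there are `(2^10 − 10^3) 2^14 = 393,216` different binary numbers in that
interval. If decimal numbers are represented with 8 digits, then there are `(2^10 − 10^3) 10^4 =
240,000` decimal numbers in the same interval. There is no way that 240,000 decimal numbers could
represent 393,216 different binary numbers. So 8 decimal digits are not enough to uniquely
represent each single precision binary number. To show that 9 digits are sufficient, it is
enough to show that the spacing between binary numbers is always greater than the spacing between
decimal numbers. This will ensure that for each decimal number `N`, the interval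
`[N − ½ ulp, N + ½ ulp]` contains at most one binary number. Thus each binary number rounds to a
unique decimal number which in turn rounds to a unique binary number. To show that the spacing
between binary numbers is always greater than the spacing between decimal numbers, consider an
interval `[10^n, 10^(n+1)]`. On this interval, the spacing between consecutive decimal numbers is
`10^((n+1)−9)`. On `[10^n, 2^m]`, where `m` is the smallest integer so that `10^n < 2^m`, the
spacing of binary numbers is `2^(m−24)`, and the spacing gets larger further on in the interval.
Thus it is enough to check that `10^((n+1)−9) < 2^(m−24)`. But in fact, since `10^n < 2^m`, then
`10^((n+1)−9) = 10^n 10^(−8) < 2^m 10^(−8) < 2^m 2^(−24)`. ∎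

The same argument applied to double precision shows that 17 decimal digits are required to
recover a double precision number."

## What is formalised, and how

The floating-point sets and the rounding relation are those of `FreeFormatOutput`:
`FP β t = {f · β^k : f, k ∈ ℤ, β^(t−1) ≤ |f| < β^t}` (unbounded exponent range — Goldberg's
binary32/binary64 numbers away from the subnormal and overflow thresholds are members of
`FP 2 24` / `FP 2 53`, and his "8 digit decimal numbers" are `FP 10 8`) and `IsNearestIn S x X`
("`X ∈ S` is a closest point of `S` to `x`", no tie rule). "Recovering the binary number" is the
read-back property of `FreeFormatOutput.freeFormat_readBack`:
`∀ x X x', x ∈ FP 2 p → IsNearestIn (FP 10 P) x X → IsNearestIn (FP 2 p) X x' → x' = x`.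

* `spacing_above` / `spacing_below` — Goldberg's "spacing between consecutive [`P`-digit radix-`B`]
  numbers": above a member `X = F · B^k` (`B^(P−1) ≤ F < B^P`) the next member of `FP B P` is
  `≥ X + B^k`, and, when `F > B^(P−1)`, the previous one is `≤ X − B^k`. These two are COROLLARIES
  (kept by name, in Goldberg's phrasing) of the in-tree lemmas `FP.succ_le` / `FP.le_pred` of
  `BrentZimmermann2010/DoubleRounding.lean` — the anchor dedup rule: one proof in the tree.
* `binary32_decimal8_collision` — the first sentence of Theorem 15, by an EXPLICIT pair inside
  Goldberg's interval `[1000, 1024)` rather than by his count (the count itself is recorded as an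
  `example`: `393216 > 240000`): the consecutive binary32 numbers `x₁ = 1000 + 2^(−14) =
  16384001/16384` and `x₂ = 1000 + 2^(−13) = 16384002/16384` both have `X = 1000.0001 =
  10000001/10000` as their closest 8-digit decimal, and the closest binary32 number to `X` is `x₂`
  (`decimal8_readBack_nearest`), so `x₁` is not recovered: `binary32_decimal8_readBack_fails`.
* `collision_at_one` — the same spacing phenomenon at the common grid point `1` of all formats:
  if `2 · B^(P−1) ≤ b^(p−1)` then `1` and its successor `1 + b^(1−p)` in `FP b p` both have `1` as a
  closest point of `FP B P` (the `FP B P`-spacing above `1` is `B^(1−P) ≥ 2 b^(1−p)`), and then the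
  read-back property fails (`readBack_fails_of_collision`, since `1` reads back as `1`).
* `binary64_decimal16_collision`, `binary64_readBack_iff` — "17 decimal digits are required to
  recover a double precision number", made sharp: for `P ≥ 1` the read-back property from
  `FP 10 P` to `FP 2 53` holds iff `17 ≤ P` (failure for `P ≤ 16` by `collision_at_one`, as
  `2 · 10^(P−1) ≤ 2 · 10^15 ≤ 2^52`; success for `P ≥ 17` by the Brent–Zimmermann criterion
  `2^53 < 10^(P−1)`, `FreeFormatOutput.freeFormat_readBack`).
* `binary32_readBack_iff` — Theorem 15 made sharp in the same way: for `P ≥ 1` the read-back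
  property from `FP 10 P` to `FP 2 24` holds iff `9 ≤ P` (`P ≤ 7` by `collision_at_one`,
  `P = 8` by the pair above, `P ≥ 9` by `2^24 < 10^(P−1)`).

Not formalised: the counting form of Goldberg's proof as a statement about all of `[1000, 1024)`
(only the two displayed products are checked), IEEE exponent-range side conditions (the formats
here have unbounded exponents, so subnormals and overflow are out of scope, as in Goldberg's
argument), and the flag-based exact-conversion procedure discussed after the theorem.
-/

namespace Literature.ComputerArithmetic.Goldberg1991

open Literature.ComputerArithmetic.BrentZimmermann2010

/-! ## Grid spacing of `FP B P` next to a member -/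

/-- **Spacing above a member.** If `X = F · B^k` with `F, k` integers, `B^(P−1) ≤ F < B^P`
(so `X ∈ FP B P`, `X > 0`), then every member `Y > X` of `FP B P` satisfies `Y ≥ X + B^k`:
"on this interval, the spacing between consecutive decimal numbers is `10^((n+1)−9)`" (here for a
general radix `B` and precision `P`; members of a lower exponent are `< B^(P−1) · B^k ≤ X`, members
of exponent `≥ k` are integer multiples of `B^k`). This is the in-tree lemma `FP.succ_le` of
`BrentZimmermann2010/DoubleRounding.lean` (Brent–Zimmermann §3.1.9, "one ulp from a rounding
boundary"), kept here by name as a COROLLARY in Goldberg's phrasing (real-cast hypotheses,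
conclusion `X + B^k ≤ Y`) — one proof in the tree, per the anchor dedup rule.
[cite: Goldberg1991, Theorem 15, proof (reprint p. 218)] -/
theorem spacing_above {B P : ℕ} (hB : 2 ≤ B) {F k : ℤ} {X : ℝ}
    (hF1 : (B : ℝ) ^ (P - 1) ≤ (F : ℝ)) (hF2 : (F : ℝ) < (B : ℝ) ^ P)
    (hX : X = (F : ℝ) * (B : ℝ) ^ k) {Y : ℝ} (hY : Y ∈ FP B P) (hlt : X < Y) :
    X + (B : ℝ) ^ k ≤ Y := by
  -- Corollary of `FP.succ_le` (`BrentZimmermann2010/DoubleRounding.lean`): same fact, restated with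
  -- a real-cast hypothesis and the conclusion `X + B^k ≤ Y` (anchor dedup rule: one proof in tree).
  have hP : 1 ≤ P := by
    rcases Nat.eq_zero_or_pos P with h | h
    · subst h; simp at hF1 hF2; linarith
    · exact h
  have hF1' : (B : ℤ) ^ (P - 1) ≤ F := by
    have h1 : (((B : ℤ) ^ (P - 1) : ℤ) : ℝ) ≤ ((F : ℤ) : ℝ) := by push_cast; exact hF1
    exact_mod_cast h1
  subst hX
  have h := FP.succ_le hB hP k hF1' hY hlt
  have e : ((F + 1 : ℤ) : ℝ) * (B : ℝ) ^ k = (F : ℝ) * (B : ℝ) ^ k + (B : ℝ) ^ k := by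
    push_cast; ring
  linarith

/-- **Spacing below a member that is not the least of its exponent.** If `X = F · B^k` with
`B^(P−1) < F < B^P`, then every member `Y < X` of `FP B P` satisfies `Y ≤ X − B^k` (members of a
lower exponent are `< B^(P−1) · B^k ≤ (F − 1) · B^k`). At the least significand `F = B^(P−1)` the
spacing below is `B^(k−1)` instead — "the spacing gets larger further on in the interval".
COROLLARY (by name, same fact) of the in-tree lemma `FP.le_pred` of
`BrentZimmermann2010/DoubleRounding.lean`.
[cite: Goldberg1991, Theorem 15, proof (reprint p. 218)] -/
theorem spacing_below {B P : ℕ} (hB : 2 ≤ B) {F k : ℤ} {X : ℝ}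
    (hF1 : (B : ℝ) ^ (P - 1) < (F : ℝ)) (hF2 : (F : ℝ) < (B : ℝ) ^ P)
    (hX : X = (F : ℝ) * (B : ℝ) ^ k) {Y : ℝ} (hY : Y ∈ FP B P) (hlt : Y < X) :
    Y ≤ X - (B : ℝ) ^ k := by
  -- Corollary of `FP.le_pred` (`BrentZimmermann2010/DoubleRounding.lean`), as for `spacing_above`.
  have hP : 1 ≤ P := by
    rcases Nat.eq_zero_or_pos P with h | h
    · subst h; simp at hF1 hF2; linarith
    · exact h
  have hF1' : (B : ℤ) ^ (P - 1) < F := by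
    have h1 : (((B : ℤ) ^ (P - 1) : ℤ) : ℝ) < ((F : ℤ) : ℝ) := by push_cast; exact hF1
    exact_mod_cast h1
  subst hX
  have h := FP.le_pred hB hP k hF1' hY hlt
  have e : ((F - 1 : ℤ) : ℝ) * (B : ℝ) ^ k = (F : ℝ) * (B : ℝ) ^ k - (B : ℝ) ^ k := by
    push_cast; ring
  linarith

/-! ## The common grid point `1` -/

/-- `1 = b^(p−1) · b^(−(p−1))` is a member of every format `FP b p` (`b ≥ 2`, `p ≥ 1`).
[cite: Goldberg1991, Theorem 15, proof (reprint p. 218)] -/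
theorem one_mem {b p : ℕ} (hb : 2 ≤ b) (hp : 1 ≤ p) : (1 : ℝ) ∈ FP b p := by
  obtain ⟨q, rfl⟩ : ∃ q, p = q + 1 := ⟨p - 1, by omega⟩
  have hb0 : (0 : ℝ) < b := by exact_mod_cast (by omega : 0 < b)
  have hb1 : (1 : ℝ) < b := by exact_mod_cast (by omega : 1 < b)
  refine ⟨(b : ℤ) ^ q, -(q : ℤ), ?_, ?_, ?_⟩
  · push_cast
    rw [abs_of_pos (pow_pos hb0 q)]
  · push_cast
    rw [abs_of_pos (pow_pos hb0 q)]
    exact pow_lt_pow_right₀ hb1 (by omega)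
  · push_cast
    rw [zpow_neg, zpow_natCast, mul_inv_cancel₀ (pow_pos hb0 q).ne']

/-- The successor of `1` in `FP b p`: `1 + b^(−(p−1)) = (b^(p−1) + 1) · b^(−(p−1))` is a member
(`b ≥ 2`, `p ≥ 2`, so that `b^(p−1) + 1 < b^p`); "the spacing of binary numbers is `2^(m−24)`"
just above `2^(m−1)`, here `m = 1`.
[cite: Goldberg1991, Theorem 15, proof (reprint p. 218)] -/
theorem one_add_mem {b p : ℕ} (hb : 2 ≤ b) (hp : 2 ≤ p) :
    (1 : ℝ) + ((b : ℝ) ^ (p - 1))⁻¹ ∈ FP b p := by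
  obtain ⟨q, rfl⟩ : ∃ q, p = q + 1 := ⟨p - 1, by omega⟩
  simp only [Nat.add_sub_cancel]
  have hb0 : (0 : ℝ) < b := by exact_mod_cast (by omega : 0 < b)
  have hb2 : (2 : ℝ) ≤ b := by exact_mod_cast hb
  have hq : (b : ℝ) ≤ (b : ℝ) ^ q := le_self_pow₀ (by linarith) (by omega)
  have hbq : (0 : ℝ) < (b : ℝ) ^ q := pow_pos hb0 q
  refine ⟨(b : ℤ) ^ q + 1, -(q : ℤ), ?_, ?_, ?_⟩
  · push_cast
    rw [abs_of_pos (by positivity)]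
    linarith
  · push_cast
    rw [abs_of_pos (by positivity), pow_succ]
    nlinarith
  · push_cast
    rw [zpow_neg, zpow_natCast, add_mul, mul_inv_cancel₀ hbq.ne', one_mul]

/-- **Collision at `1`.** If `2 · B^(P−1) ≤ b^(p−1)` (the spacing `B^(1−P)` of `FP B P` above `1`
is at least twice the spacing `b^(1−p)` of `FP b p` above `1`), then the two consecutive members
`1` and `1 + b^(1−p)` of `FP b p` BOTH have `1` as a closest point of `FP B P` — the interval
"`[N − ½ ulp, N + ½ ulp]`" of `N = 1` contains two members of `FP b p`, which is exactly what the
spacing comparison in the proof of Theorem 15 rules out under `b^p < B^(P−1)`.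
[cite: Goldberg1991, Theorem 15, proof (reprint p. 218)] -/
theorem collision_at_one {b p B P : ℕ} (hb : 2 ≤ b) (hB : 2 ≤ B) (hP : 1 ≤ P)
    (h : 2 * B ^ (P - 1) ≤ b ^ (p - 1)) :
    IsNearestIn (FP B P) 1 1 ∧ IsNearestIn (FP B P) (1 + ((b : ℝ) ^ (p - 1))⁻¹) 1 := by
  have hb0 : (0 : ℝ) < b := by exact_mod_cast (by omega : 0 < b)
  have hB0 : (0 : ℝ) < B := by exact_mod_cast (by omega : 0 < B)
  have hB1 : (1 : ℝ) < B := by exact_mod_cast (by omega : 1 < B)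
  set u : ℝ := ((b : ℝ) ^ (p - 1))⁻¹ with hu_def
  set v : ℝ := ((B : ℝ) ^ (P - 1))⁻¹ with hv_def
  have hbb : (0 : ℝ) < (b : ℝ) ^ (p - 1) := pow_pos hb0 _
  have hBB : (0 : ℝ) < (B : ℝ) ^ (P - 1) := pow_pos hB0 _
  have hu : 0 < u := inv_pos.2 hbb
  -- `2 u ≤ v`
  have h' : (2 : ℝ) * (B : ℝ) ^ (P - 1) ≤ (b : ℝ) ^ (p - 1) := by exact_mod_cast h
  have huv : 2 * u ≤ v := by
    refine le_of_mul_le_mul_right ?_ (mul_pos hbb hBB)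
    have e1 : 2 * u * ((b : ℝ) ^ (p - 1) * (B : ℝ) ^ (P - 1)) = 2 * (B : ℝ) ^ (P - 1) := by
      rw [hu_def]; field_simp
    have e2 : v * ((b : ℝ) ^ (p - 1) * (B : ℝ) ^ (P - 1)) = (b : ℝ) ^ (p - 1) := by
      rw [hv_def]; field_simp
    rw [e1, e2]
    exact h'
  have h1B : (1 : ℝ) ∈ FP B P := one_mem hB hP
  refine ⟨⟨h1B, fun Y _ => by simp [abs_nonneg]⟩, ⟨h1B, fun Y hY => ?_⟩⟩
  rw [add_sub_cancel_left, abs_of_pos hu]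
  rcases le_or_gt Y 1 with hY1 | hY1
  · -- `Y ≤ 1 < 1 + u`
    calc u ≤ 1 + u - Y := by linarith
      _ ≤ |1 + u - Y| := le_abs_self _
  · -- `Y > 1`: then `Y ≥ 1 + v ≥ 1 + 2u`
    obtain ⟨Q, rfl⟩ : ∃ Q, P = Q + 1 := ⟨P - 1, by omega⟩
    simp only [Nat.add_sub_cancel] at hv_def hBB
    have hX : (1 : ℝ) = (((B : ℤ) ^ Q : ℤ) : ℝ) * (B : ℝ) ^ (-(Q : ℤ)) := by
      push_cast
      rw [zpow_neg, zpow_natCast, mul_inv_cancel₀ hBB.ne']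
    have hsp := spacing_above (P := Q + 1) hB (F := (B : ℤ) ^ Q) (k := -(Q : ℤ))
      (by push_cast; simp) (by push_cast; exact pow_lt_pow_right₀ hB1 (by omega))
      hX hY hY1
    have hv' : (B : ℝ) ^ (-(Q : ℤ)) = v := by rw [hv_def, zpow_neg, zpow_natCast]
    rw [hv'] at hsp
    calc u ≤ Y - (1 + u) := by linarith
      _ ≤ |Y - (1 + u)| := le_abs_self _
      _ = |1 + u - Y| := abs_sub_comm _ _

/-- From a collision to the failure of read-back: if two distinct members `x ≠ x'` of `FP b p`
have a common closest point `X` of `FP B P`, and `y` is a closest point of `FP b p` to `X`, then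
"it is not always possible to uniquely recover the binary number from the decimal one" — the
read-back property `∀ x X x', … → x' = x` of `FreeFormatOutput.freeFormat_readBack` fails
(it would force `y = x` and `y = x'`).
[cite: Goldberg1991, Theorem 15 (reprint p. 218)] -/
theorem readBack_fails_of_collision {b p B P : ℕ} {x x' X y : ℝ} (hx : x ∈ FP b p)
    (hx' : x' ∈ FP b p) (hne : x ≠ x') (h1 : IsNearestIn (FP B P) x X)
    (h2 : IsNearestIn (FP B P) x' X) (hy : IsNearestIn (FP b p) X y) :
    ¬ ∀ z Z z' : ℝ, z ∈ FP b p → IsNearestIn (FP B P) z Z → IsNearestIn (FP b p) Z z' →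
      z' = z := by
  intro H
  exact hne ((H x X y hx h1 hy).symm.trans (H x' X y hx' h2 hy))

/-- A member of a format is its own (unique) closest point: `IsNearestIn (FP b p) X X`.
[cite: Goldberg1991, Theorem 15, proof (reprint p. 218)] -/
theorem isNearestIn_self {b p : ℕ} {X : ℝ} (hX : X ∈ FP b p) : IsNearestIn (FP b p) X X :=
  ⟨hX, fun Y _ => by simp [abs_nonneg]⟩

/-! ## Double precision: "17 decimal digits are required" -/

/-- **binary64, 16 digits collide.** The consecutive binary64 numbers `1` and `1 + 2^(−52)` both
have `1` as a closest 16-digit decimal (`FP 10 16`; the decimal spacing above `1` is `10^(−15)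
≥ 2 · 2^(−52)`): "the same argument applied to double precision shows that 17 decimal digits are
required to recover a double precision number".
[cite: Goldberg1991, Theorem 15 and the sentence following its proof (reprint p. 218)] -/
theorem binary64_decimal16_collision :
    (1 : ℝ) ∈ FP 2 53 ∧ (1 : ℝ) + ((2 : ℝ) ^ 52)⁻¹ ∈ FP 2 53 ∧ (1 : ℝ) ≠ 1 + ((2 : ℝ) ^ 52)⁻¹ ∧
      IsNearestIn (FP 10 16) 1 1 ∧ IsNearestIn (FP 10 16) (1 + ((2 : ℝ) ^ 52)⁻¹) 1 := by
  have hc := collision_at_one (b := 2) (p := 53) (B := 10) (P := 16)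
    (by norm_num) (by norm_num) (by norm_num) (by norm_num)
  have hm := one_add_mem (b := 2) (p := 53) (by norm_num) (by norm_num)
  simp only [Nat.cast_ofNat, Nat.reduceSub] at hc hm
  exact ⟨one_mem (by norm_num) (by norm_num), hm, by norm_num, hc.1, hc.2⟩

/-- **binary64 read-back from `P` decimal digits holds iff `P ≥ 17`** (`P ≥ 1`): for `P ≤ 16`
the pair `1`, `1 + 2^(−52)` collides in `FP 10 P` (`2 · 10^(P−1) ≤ 2^52`) while `1` reads back
as `1`; for `P ≥ 17` the criterion `2^53 < 10^(P−1)` of Brent–Zimmermann §3.6.1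
(`FreeFormatOutput.freeFormat_readBack`) applies. This is the sharp form of "17 decimal digits
are required to recover a double precision number".
[cite: Goldberg1991, Theorem 15 and the sentence following its proof (reprint p. 218)] -/
theorem binary64_readBack_iff {P : ℕ} (hP : 1 ≤ P) :
    (∀ x X x' : ℝ, x ∈ FP 2 53 → IsNearestIn (FP 10 P) x X → IsNearestIn (FP 2 53) X x' →
      x' = x) ↔ 17 ≤ P := by
  constructor
  · intro H
    by_contra hlt
    have h16 : P - 1 ≤ 15 := by omega
    have hpow : 2 * 10 ^ (P - 1) ≤ 2 ^ (53 - 1) :=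
      calc 2 * 10 ^ (P - 1) ≤ 2 * 10 ^ 15 :=
            Nat.mul_le_mul_left 2 (Nat.pow_le_pow_right (by norm_num) h16)
        _ ≤ 2 ^ (53 - 1) := by norm_num
    have hc := collision_at_one (b := 2) (p := 53) (B := 10) (P := P)
      (by norm_num) (by norm_num) hP hpow
    have h1 : (1 : ℝ) ∈ FP 2 53 := one_mem (by norm_num) (by norm_num)
    have h2 : (1 : ℝ) + (((2 : ℕ) : ℝ) ^ (53 - 1))⁻¹ ∈ FP 2 53 :=
      one_add_mem (by norm_num) (by norm_num)
    have hne : (1 : ℝ) ≠ 1 + (((2 : ℕ) : ℝ) ^ (53 - 1))⁻¹ := by norm_num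
    exact readBack_fails_of_collision h1 h2 hne hc.1 hc.2 (isNearestIn_self h1) H
  · intro h17 x X x' hx hX hx'
    have hcrit : 2 ^ 53 < 10 ^ (P - 1) :=
      calc 2 ^ 53 < 10 ^ 16 := by norm_num
        _ ≤ 10 ^ (P - 1) := Nat.pow_le_pow_right (by norm_num) (by omega)
    exact freeFormat_readBack (by norm_num) (by norm_num) hP hcrit hx hX hx'

/-! ## Single precision: Theorem 15 -/

/-- **Theorem 15, first sentence (8 digits collide), by an explicit pair in Goldberg's interval
`[1000, 1024)`.** The consecutive binary32 numbers `x₁ = 1000 + 2^(−14) = 16384001 · 2^(−14)` and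
`x₂ = 1000 + 2^(−13) = 16384002 · 2^(−14)` (`2^23 ≤ 1638400x < 2^24`) both have
`X = 1000.0001 = 10000001 · 10^(−4) ∈ FP 10 8` as a closest 8-digit decimal: the neighbours of
`X` in `FP 10 8` are `1000.0000` and `1000.0002` (spacing `10^(−4)`), and
`|x₁ − X| ≈ 3.90·10^(−5)`, `|x₂ − X| ≈ 2.21·10^(−5)` are below `5·10^(−5)`.
[cite: Goldberg1991, Theorem 15 (reprint p. 218)] -/
theorem binary32_decimal8_collision :
    (16384001 / 16384 : ℝ) ∈ FP 2 24 ∧ (16384002 / 16384 : ℝ) ∈ FP 2 24 ∧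
      (16384001 / 16384 : ℝ) ≠ 16384002 / 16384 ∧
      IsNearestIn (FP 10 8) (16384001 / 16384) (10000001 / 10000) ∧
      IsNearestIn (FP 10 8) (16384002 / 16384) (10000001 / 10000) := by
  have hX : (10000001 / 10000 : ℝ) = ((10000001 : ℤ) : ℝ) * ((10 : ℕ) : ℝ) ^ (-4 : ℤ) := by
    norm_num
  have hXmem : (10000001 / 10000 : ℝ) ∈ FP 10 8 :=
    ⟨10000001, -4, by norm_num, by norm_num, by norm_num⟩
  -- neighbours of `X` in `FP 10 8`
  have hup : ∀ Y ∈ FP 10 8, (10000001 / 10000 : ℝ) < Y → (10000002 / 10000 : ℝ) ≤ Y := by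
    intro Y hY hlt
    have h := spacing_above (B := 10) (P := 8) (by norm_num) (F := 10000001) (k := -4)
      (by norm_num) (by norm_num) hX hY hlt
    norm_num at h ⊢
    linarith
  have hdn : ∀ Y ∈ FP 10 8, Y < (10000001 / 10000 : ℝ) → Y ≤ 1000 := by
    intro Y hY hlt
    have h := spacing_below (B := 10) (P := 8) (by norm_num) (F := 10000001) (k := -4)
      (by norm_num) (by norm_num) hX hY hlt
    norm_num at h ⊢
    linarith
  refine ⟨⟨16384001, -14, by norm_num, by norm_num, by norm_num⟩,
    ⟨16384002, -14, by norm_num, by norm_num, by norm_num⟩, by norm_num, ⟨hXmem, ?_⟩, ⟨hXmem, ?_⟩⟩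
  · intro Y hY
    rw [abs_of_neg (by norm_num)]
    rcases lt_trichotomy Y (10000001 / 10000 : ℝ) with hlt | rfl | hgt
    · have := hdn Y hY hlt
      calc -((16384001 / 16384 : ℝ) - 10000001 / 10000) ≤ 16384001 / 16384 - Y := by linarith
        _ ≤ |16384001 / 16384 - Y| := le_abs_self _
    · rw [abs_of_neg (by norm_num)]
    · have := hup Y hY hgt
      calc -((16384001 / 16384 : ℝ) - 10000001 / 10000) ≤ Y - 16384001 / 16384 := by linarith
        _ ≤ |Y - 16384001 / 16384| := le_abs_self _
        _ = |16384001 / 16384 - Y| := abs_sub_comm _ _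
  · intro Y hY
    rw [abs_of_pos (by norm_num)]
    rcases lt_trichotomy Y (10000001 / 10000 : ℝ) with hlt | rfl | hgt
    · have := hdn Y hY hlt
      calc (16384002 / 16384 : ℝ) - 10000001 / 10000 ≤ 16384002 / 16384 - Y := by linarith
        _ ≤ |16384002 / 16384 - Y| := le_abs_self _
    · rw [abs_of_pos (by norm_num)]
    · have := hup Y hY hgt
      calc (16384002 / 16384 : ℝ) - 10000001 / 10000 ≤ Y - 16384002 / 16384 := by linarith
        _ ≤ |Y - 16384002 / 16384| := le_abs_self _
        _ = |16384002 / 16384 - Y| := abs_sub_comm _ _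

/-- The closest binary32 number to `X = 1000.0001` is `x₂ = 16384002 · 2^(−14)` (its neighbours in
`FP 2 24` are `x₁ = x₂ − 2^(−14)` and `x₂ + 2^(−14)`), so reading `X` back "to the closest binary
number" yields `x₂`, never `x₁`.
[cite: Goldberg1991, Theorem 15 (reprint p. 218)] -/
theorem decimal8_readBack_nearest :
    IsNearestIn (FP 2 24) (10000001 / 10000) (16384002 / 16384) := by
  have hx : (16384002 / 16384 : ℝ) = ((16384002 : ℤ) : ℝ) * ((2 : ℕ) : ℝ) ^ (-14 : ℤ) := by
    norm_num
  refine ⟨⟨16384002, -14, by norm_num, by norm_num, by norm_num⟩, fun Z hZ => ?_⟩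
  rw [abs_of_neg (by norm_num)]
  rcases lt_trichotomy Z (16384002 / 16384 : ℝ) with hlt | rfl | hgt
  · have h := spacing_below (B := 2) (P := 24) (by norm_num) (F := 16384002) (k := -14)
      (by norm_num) (by norm_num) hx hZ hlt
    norm_num at h
    calc -((10000001 / 10000 : ℝ) - 16384002 / 16384) ≤ 10000001 / 10000 - Z := by linarith
      _ ≤ |10000001 / 10000 - Z| := le_abs_self _
  · rw [abs_of_neg (by norm_num)]
  · have h := spacing_above (B := 2) (P := 24) (by norm_num) (F := 16384002) (k := -14)
      (by norm_num) (by norm_num) hx hZ hgt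
    norm_num at h
    calc -((10000001 / 10000 : ℝ) - 16384002 / 16384) ≤ Z - 10000001 / 10000 := by linarith
      _ ≤ |Z - 10000001 / 10000| := le_abs_self _
      _ = |10000001 / 10000 - Z| := abs_sub_comm _ _

/-- **Theorem 15, first sentence, as the failure of read-back**: with 8 decimal digits
"it is not always possible to uniquely recover the binary number from the decimal one"
(`x₁ = 1000 + 2^(−14)` prints as `1000.0001`, which reads back as `x₂ = 1000 + 2^(−13)`).
[cite: Goldberg1991, Theorem 15 (reprint p. 218)] -/
theorem binary32_decimal8_readBack_fails :
    ¬ ∀ x X x' : ℝ, x ∈ FP 2 24 → IsNearestIn (FP 10 8) x X → IsNearestIn (FP 2 24) X x' →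
      x' = x := by
  obtain ⟨h1, h2, hne, hc1, hc2⟩ := binary32_decimal8_collision
  exact readBack_fails_of_collision h1 h2 hne hc1 hc2 decimal8_readBack_nearest

/-- **Theorem 15, sharp form: binary32 read-back from `P` decimal digits holds iff `P ≥ 9`**
(`P ≥ 1`): for `P ≤ 7` the pair `1`, `1 + 2^(−23)` collides in `FP 10 P` (`2 · 10^(P−1) ≤ 2^23`),
for `P = 8` the pair `1000 + 2^(−14)`, `1000 + 2^(−13)` does, and for `P ≥ 9` "converting the
decimal number to the closest binary number will recover the original floating-point number" by
the spacing criterion `2^24 < 10^(P−1)` (`FreeFormatOutput.freeFormat_readBack`).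
[cite: Goldberg1991, Theorem 15 (reprint p. 218)] -/
theorem binary32_readBack_iff {P : ℕ} (hP : 1 ≤ P) :
    (∀ x X x' : ℝ, x ∈ FP 2 24 → IsNearestIn (FP 10 P) x X → IsNearestIn (FP 2 24) X x' →
      x' = x) ↔ 9 ≤ P := by
  constructor
  · intro H
    by_contra hlt
    rcases Nat.lt_or_ge P 8 with h7 | h8
    · -- `P ≤ 7`: collision at `1`
      have h6 : P - 1 ≤ 6 := by omega
      have hpow : 2 * 10 ^ (P - 1) ≤ 2 ^ (24 - 1) :=
        calc 2 * 10 ^ (P - 1) ≤ 2 * 10 ^ 6 :=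
              Nat.mul_le_mul_left 2 (Nat.pow_le_pow_right (by norm_num) h6)
          _ ≤ 2 ^ (24 - 1) := by norm_num
      have hc := collision_at_one (b := 2) (p := 24) (B := 10) (P := P)
        (by norm_num) (by norm_num) hP hpow
      have h1 : (1 : ℝ) ∈ FP 2 24 := one_mem (by norm_num) (by norm_num)
      have h2 : (1 : ℝ) + (((2 : ℕ) : ℝ) ^ (24 - 1))⁻¹ ∈ FP 2 24 :=
        one_add_mem (by norm_num) (by norm_num)
      have hne : (1 : ℝ) ≠ 1 + (((2 : ℕ) : ℝ) ^ (24 - 1))⁻¹ := by norm_num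
      exact readBack_fails_of_collision h1 h2 hne hc.1 hc.2 (isNearestIn_self h1) H
    · -- `P = 8`: Goldberg's interval
      obtain rfl : P = 8 := by omega
      exact binary32_decimal8_readBack_fails H
  · intro h9 x X x' hx hX hx'
    have hcrit : 2 ^ 24 < 10 ^ (P - 1) :=
      calc 2 ^ 24 < 10 ^ 8 := by norm_num
        _ ≤ 10 ^ (P - 1) := Nat.pow_le_pow_right (by norm_num) (by omega)
    exact freeFormat_readBack (by norm_num) (by norm_num) hP hcrit hx hX hx'

/-- Goldberg's count for `[1000, 1024)`: `(2^10 − 10^3) · 2^14 = 393,216` binary32 numbers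
against `(2^10 − 10^3) · 10^4 = 240,000` 8-digit decimals.
[cite: Goldberg1991, Theorem 15, proof (reprint p. 218)] -/
example : (2 ^ 10 - 10 ^ 3) * 2 ^ 14 = 393216 ∧ (2 ^ 10 - 10 ^ 3) * 10 ^ 4 = 240000 ∧
    240000 < 393216 := by norm_num

end Literature.ComputerArithmetic.Goldberg1991
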